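import Summits.AnomalousDissipation.AnomalousDissipation.Theorems.MomentParityQuarticGateCubicComplexifyMain
import Summits.AnomalousDissipation.AnomalousDissipation.Theorems.MomentParityQuarticGateFourierDictionaryPart2

/-!
# Complexified reduction for the axial Casimir stubs (line `axis-sectors` of crux `MomentParity.QuarticGate`), IV

The complexified OBSERVABLE `F(c) = Pℂ((ℓ_{vⱼ}(c))ⱼ)`, `Pℂ = map (algebraMap ℝ ℂ) P`,
`ℓ_v(c) = Σ_{k∈S*} Σᵢ c k i · v (-k) i`, and its behaviour under the TWISTS `c ↦ (χ k • c k)_k`, in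
particular the shear twists `χ = e_·(-a)` of the dictionary (part 2: the coefficients of the translate
`τ_a u` are `e_k(-a) • coef u k`):
* `observableC_two_families` — along a pencil `z₀ a + z₁ b`, `F` is a polynomial in `z ∈ ℂ²`;
* `observableC_eq_zero_of_forall_admissible` — `F = 0` on admissible families ⟹ `F = 0` on all complex
  families transversal on / supported in `S*`;
* `observableC_twist_eq_of_forall_admissible` — `F(e_·(-a) • c) = F(c)` on admissible families ⟹ the
  same on all complex families transversal on / supported in `S*`;
* `observableC_twist_eq_ofReal` — for a level-`N` field, `F_{ĝ}(e_·(-a) • coef u) = ↑P((u, gⱼ(· + a))ⱼ)`;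
* `observableC_twist_eq_of_axialObs` — CONSUMER FORM: the shear-invariance clause `AxialObs` of the
  stubs implies `F_{ĝ}(e_·(-a) • c) = F_{ĝ}(c)` for every `a ∈ H_L` and EVERY complex family `c`
  transversal on and supported in `S* = (freqBall N).erase 0`.
-/

namespace Summit.AnomalousDissipation.AnomalousDissipation.Theorems.MomentParityQuarticGate

open MeasureTheory Filter
open scoped InnerProductSpace RealInnerProductSpace ComplexConjugate ENNReal
open Literature.Analysis.FunctionSpaces Literature.Analysis.FluidPDE
open Summit.AnomalousDissipation.AnomalousDissipation.Theses.MomentParity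
open Summit.AnomalousDissipation.AnomalousDissipation.Theorems.QuarticGate.Negative

-- `Summit.<Summit>.<Problem>` is the tree's mandated summit-side namespace (CONVENTIONS §2); for this
-- single-conjunct summit the two coincide, so the duplicate is deliberate.
set_option linter.dupNamespace false

noncomputable section

section Observable

variable {N m : ℕ}

/-- **The complexified observable along a pencil is a polynomial in `(z₀, z₁)`.** [folklore] -/
theorem observableC_two_families (N : ℕ) {m : ℕ} (a b : (Fin 3 → ℤ) → EuclideanSpace ℂ (Fin 3))
    (v : Fin m → (Fin 3 → ℤ) → EuclideanSpace ℂ (Fin 3)) (P : MvPolynomial (Fin m) ℝ) :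
    ∃ Q : MvPolynomial (Fin 2) ℂ, ∀ z : Fin 2 → ℂ,
      MvPolynomial.eval (fun j => ∑ k ∈ (Torus.freqBall N).erase 0, ∑ i', (z 0 • a k + z 1 • b k) i' * v j (-k) i')
        (MvPolynomial.map (algebraMap ℝ ℂ) P) = MvPolynomial.eval z Q := by
  set L : Fin m → MvPolynomial (Fin 2) ℂ := fun j =>
    MvPolynomial.C (∑ k ∈ (Torus.freqBall N).erase 0, ∑ i', a k i' * v j (-k) i') * MvPolynomial.X 0 +
    MvPolynomial.C (∑ k ∈ (Torus.freqBall N).erase 0, ∑ i', b k i' * v j (-k) i') * MvPolynomial.X 1 with hL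
  refine ⟨MvPolynomial.bind₁ L (MvPolynomial.map (algebraMap ℝ ℂ) P), fun z => ?_⟩
  have hℓ : (fun j => ∑ k ∈ (Torus.freqBall N).erase 0, ∑ i', (z 0 • a k + z 1 • b k) i' * v j (-k) i') =
      fun j => MvPolynomial.eval z (L j) := by
    funext j
    rw [ell_pencil, hL]
    simp only [map_add, map_mul, MvPolynomial.eval_C, MvPolynomial.eval_X]
    ring
  rw [hℓ, eval_bind₁_eq]

/-- **`F = 0` on admissible families implies `F = 0` on all complex families** transversal on and
supported in `S*` (real form + pencil, as for the Casimir expression). [folklore] -/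
theorem observableC_eq_zero_of_forall_admissible (N : ℕ) {m : ℕ}
    (v : Fin m → (Fin 3 → ℤ) → EuclideanSpace ℂ (Fin 3)) (P : MvPolynomial (Fin m) ℝ)
    (hF : ∀ c : (Fin 3 → ℤ) → EuclideanSpace ℂ (Fin 3), Torus.IsConjSymm c →
      Torus.IsTransversal ((Torus.freqBall N).erase 0) c →
      (∀ k ∉ (Torus.freqBall N).erase (0 : Fin 3 → ℤ), c k = 0) →
      MvPolynomial.eval (fun j => ∑ k ∈ (Torus.freqBall N).erase 0, ∑ i', c k i' * v j (-k) i')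
        (MvPolynomial.map (algebraMap ℝ ℂ) P) = 0)
    (c : (Fin 3 → ℤ) → EuclideanSpace ℂ (Fin 3)) (hT : Torus.IsTransversal ((Torus.freqBall N).erase 0) c)
    (hsupp : ∀ k ∉ (Torus.freqBall N).erase (0 : Fin 3 → ℤ), c k = 0) :
    MvPolynomial.eval (fun j => ∑ k ∈ (Torus.freqBall N).erase 0, ∑ i', c k i' * v j (-k) i')
      (MvPolynomial.map (algebraMap ℝ ℂ) P) = 0 := by
  obtain ⟨a, b, ha, hb, hTa, hTb, hsa, hsb, hc⟩ :=
    exists_admissible_decomposition neg_mem_freqBall_erase_zero c hT hsupp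
  obtain ⟨Q, hQ⟩ := observableC_two_families N a b v P
  have hQ0 : Q = 0 := by
    refine mvPolynomial_eq_zero_of_forall_eval_ofReal_eq_zero Q fun x => ?_
    rw [← hQ fun i => (x i : ℂ)]
    obtain ⟨h1, h2, h3⟩ := admissible_real_combination ha hb hTa hTb hsa hsb (x 0) (x 1)
    exact hF _ h1 h2 h3
  have key := hQ ![1, Complex.I]
  rw [hQ0, map_zero] at key
  simp only [Matrix.cons_val_zero, Matrix.cons_val_one, one_smul] at key
  have hc' : c = fun k => a k + Complex.I • b k := funext hc
  simp only [hc']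
  exact key

end Observable

/-! ## Twists -/

section Twist

variable {N m : ℕ}

/-- A twist of a pencil is the pencil of the twists. [folklore] -/
theorem twist_pencil (χ : (Fin 3 → ℤ) → ℂ) (a b : (Fin 3 → ℤ) → EuclideanSpace ℂ (Fin 3)) (z : Fin 2 → ℂ) :
    (fun k => χ k • (z 0 • a k + z 1 • b k)) = fun k => z 0 • (χ k • a k) + z 1 • (χ k • b k) := by
  funext k
  rw [smul_add, smul_comm (χ k) (z 0), smul_comm (χ k) (z 1)]

/-- **Twist invariance on admissible families implies twist invariance on all complex families.** For a
character-type weight `χ` preserving admissibility (`χ = e_·(-a)`): if `F(χ • c) = F(c)` for all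
admissible `c` then `F(χ • c) = F(c)` for every complex family transversal on and supported in `S*`. [folklore] -/
theorem observableC_twist_eq_of_forall_admissible (N : ℕ) {m : ℕ}
    (v : Fin m → (Fin 3 → ℤ) → EuclideanSpace ℂ (Fin 3)) (P : MvPolynomial (Fin m) ℝ) (a : UnitAddTorus (Fin 3))
    (hF : ∀ c : (Fin 3 → ℤ) → EuclideanSpace ℂ (Fin 3), Torus.IsConjSymm c →
      Torus.IsTransversal ((Torus.freqBall N).erase 0) c →
      (∀ k ∉ (Torus.freqBall N).erase (0 : Fin 3 → ℤ), c k = 0) →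
      MvPolynomial.eval (fun j => ∑ k ∈ (Torus.freqBall N).erase 0, ∑ i',
          ((UnitAddTorus.mFourier k (-a) : ℂ) • c k) i' * v j (-k) i') (MvPolynomial.map (algebraMap ℝ ℂ) P) =
        MvPolynomial.eval (fun j => ∑ k ∈ (Torus.freqBall N).erase 0, ∑ i', c k i' * v j (-k) i')
          (MvPolynomial.map (algebraMap ℝ ℂ) P))
    (c : (Fin 3 → ℤ) → EuclideanSpace ℂ (Fin 3)) (hT : Torus.IsTransversal ((Torus.freqBall N).erase 0) c)
    (hsupp : ∀ k ∉ (Torus.freqBall N).erase (0 : Fin 3 → ℤ), c k = 0) :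
    MvPolynomial.eval (fun j => ∑ k ∈ (Torus.freqBall N).erase 0, ∑ i',
        ((UnitAddTorus.mFourier k (-a) : ℂ) • c k) i' * v j (-k) i') (MvPolynomial.map (algebraMap ℝ ℂ) P) =
      MvPolynomial.eval (fun j => ∑ k ∈ (Torus.freqBall N).erase 0, ∑ i', c k i' * v j (-k) i')
        (MvPolynomial.map (algebraMap ℝ ℂ) P) := by
  obtain ⟨a', b', ha, hb, hTa, hTb, hsa, hsb, hc⟩ :=
    exists_admissible_decomposition neg_mem_freqBall_erase_zero c hT hsupp
  -- the two pencils: twisted and untwisted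
  obtain ⟨Q₁, hQ₁⟩ := observableC_two_families N (fun k => (UnitAddTorus.mFourier k (-a) : ℂ) • a' k)
    (fun k => (UnitAddTorus.mFourier k (-a) : ℂ) • b' k) v P
  obtain ⟨Q₂, hQ₂⟩ := observableC_two_families N a' b' v P
  have eχ : ∀ (k : Fin 3 → ℤ) (s t : ℂ), (UnitAddTorus.mFourier k (-a) : ℂ) • (s • a' k + t • b' k) =
      s • ((UnitAddTorus.mFourier k (-a) : ℂ) • a' k) + t • ((UnitAddTorus.mFourier k (-a) : ℂ) • b' k) :=
    fun k s t => by rw [smul_add, smul_comm _ s, smul_comm _ t]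
  -- `Q₁ - Q₂` vanishes on `ℝ²`
  have hQ : Q₁ - Q₂ = 0 := by
    refine mvPolynomial_eq_zero_of_forall_eval_ofReal_eq_zero _ fun x => ?_
    rw [map_sub, ← hQ₁ fun i => (x i : ℂ), ← hQ₂ fun i => (x i : ℂ), sub_eq_zero]
    obtain ⟨h1, h2, h3⟩ := admissible_real_combination ha hb hTa hTb hsa hsb (x 0) (x 1)
    have h := hF _ h1 h2 h3
    simp only [eχ] at h
    exact h
  have key₁ := hQ₁ ![1, Complex.I]
  have key₂ := hQ₂ ![1, Complex.I]
  rw [sub_eq_zero] at hQ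
  rw [hQ] at key₁
  simp only [Matrix.cons_val_zero, Matrix.cons_val_one, one_smul] at key₁ key₂
  have hc' : c = fun k => a' k + Complex.I • b' k := funext hc
  have hcχ : (fun k => (UnitAddTorus.mFourier k (-a) : ℂ) • c k) =
      fun k => (UnitAddTorus.mFourier k (-a) : ℂ) • a' k + Complex.I • ((UnitAddTorus.mFourier k (-a) : ℂ) • b' k) := by
    funext k
    rw [hc k, smul_add, smul_comm _ Complex.I]
  simp only [hc']
  rw [key₂]
  have e : (fun j => ∑ k ∈ (Torus.freqBall N).erase 0, ∑ i',
      ((UnitAddTorus.mFourier k (-a) : ℂ) • (a' k + Complex.I • b' k)) i' * v j (-k) i') =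
      fun j => ∑ k ∈ (Torus.freqBall N).erase 0, ∑ i',
        ((UnitAddTorus.mFourier k (-a) : ℂ) • a' k + Complex.I • ((UnitAddTorus.mFourier k (-a) : ℂ) • b' k)) i' *
          v j (-k) i' := by
    funext j
    refine Finset.sum_congr rfl fun k _ => Finset.sum_congr rfl fun i' _ => ?_
    rw [smul_add, smul_comm _ Complex.I]
  rw [e]
  exact key₁

/-- **The complexified observable at the twisted coefficients of a level-`N` field is the observable of
the shifted tests**: `F_{ĝ}(e_·(-a) • coef u) = ↑P((u, gⱼ(· + a))ⱼ)` (parts 1–2 of the dictionary). [folklore] -/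
theorem observableC_twist_eq_ofReal {u : Torus.energySpace (Fin 3)} (hu : IsLevel N u)
    (g : Fin m → UnitAddTorus (Fin 3) → EuclideanSpace ℝ (Fin 3)) (hg : ∀ i, IsBandTest N (g i))
    (P : MvPolynomial (Fin m) ℝ) (a : UnitAddTorus (Fin 3)) :
    MvPolynomial.eval (fun j => ∑ k ∈ (Torus.freqBall N).erase 0, ∑ i',
        ((UnitAddTorus.mFourier k (-a) : ℂ) • coef u k) i' * tcoef (g j) (-k) i') (MvPolynomial.map (algebraMap ℝ ℂ) P) =
      ((MvPolynomial.eval (fun j => Torus.pairing u.1 (fun x => g j (x + a))) P : ℝ) : ℂ) := by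
  obtain ⟨u', hu', h⟩ := exists_isLevel_coef_eq_twist hu a
  rw [eval_pairing_shifted hu hu' h g P, eval_pairing_eq_eval_coef u' g hg P,
    ← observableC_eq_ofReal (isConjSymm_coef u') g hg P]
  simp only [h]

/-- **CONSUMER FORM — `AxialObs`, complexified.** If the observable `p = P((·, g))` (band tests `g`) is
invariant under the finite shear group `H_L` on level-`N` fields, then the complexified observable is
twist invariant, `F_{ĝ}(e_·(-a) • c) = F_{ĝ}(c)`, for every `a ∈ H_L` and EVERY complex family `c`
transversal on and supported in `S*`. [folklore] -/
theorem observableC_twist_eq_of_axialObs {L : ℕ} (g : Fin m → UnitAddTorus (Fin 3) → EuclideanSpace ℝ (Fin 3))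
    (hg : ∀ i, IsBandTest N (g i)) (P : MvPolynomial (Fin m) ℝ)
    (hobs : ∀ a : UnitAddTorus (Fin 3), a 1 = 0 → L • a = 0 → ∀ u : Torus.energySpace (Fin 3), IsLevel N u →
      MvPolynomial.eval (fun j => Torus.pairing u.1 (fun x => g j (x + a))) P =
        MvPolynomial.eval (fun j => Torus.pairing u.1 (g j)) P)
    (a : UnitAddTorus (Fin 3)) (ha1 : a 1 = 0) (haL : L • a = 0)
    (c : (Fin 3 → ℤ) → EuclideanSpace ℂ (Fin 3)) (hT : Torus.IsTransversal ((Torus.freqBall N).erase 0) c)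
    (hsupp : ∀ k ∉ (Torus.freqBall N).erase (0 : Fin 3 → ℤ), c k = 0) :
    MvPolynomial.eval (fun j => ∑ k ∈ (Torus.freqBall N).erase 0, ∑ i',
        ((UnitAddTorus.mFourier k (-a) : ℂ) • c k) i' * tcoef (g j) (-k) i') (MvPolynomial.map (algebraMap ℝ ℂ) P) =
      MvPolynomial.eval (fun j => ∑ k ∈ (Torus.freqBall N).erase 0, ∑ i', c k i' * tcoef (g j) (-k) i')
        (MvPolynomial.map (algebraMap ℝ ℂ) P) := by
  refine observableC_twist_eq_of_forall_admissible N (fun j => tcoef (g j)) P a (fun c' hc' hT' hsupp' => ?_)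
    c hT hsupp
  obtain ⟨u, hu, hcoef, -⟩ := exists_isLevel_coef_eq N c' hc' hT' hsupp'
  have hcu : coef u = c' := funext hcoef
  rw [← hcu, observableC_twist_eq_ofReal hu g hg P a, hobs a ha1 haL u hu, eval_pairing_eq_eval_coef u g hg P,
    ← observableC_eq_ofReal (isConjSymm_coef u) g hg P]

end Twist

end

/-! ## Registered sub-goal (summary) -/

/-- **Registered sub-goal `cubicComplexify_observableC_twist_eq_of_axialObs` (summary of this file)**: the
shear-invariance clause (`AxialObs`) of the axial Casimir stubs for `p = P((·, g))` with band tests `g`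
implies that the conjugation-free complexified observable `Pℂ((Σ_{k∈S*} Σᵢ' c k i' · ĝⱼ(-k) i')ⱼ)` is
invariant under the shear twists `c ↦ (e_k(-a) • c k)_k`, `a ∈ H_L`, for EVERY complex family `c`
transversal on and supported in `S* = (freqBall N).erase 0`. [folklore] -/
theorem cubicComplexify_observableC_twist_eq_of_axialObs : ∀ (N L m : ℕ) (g : Fin m → UnitAddTorus (Fin 3) → EuclideanSpace ℝ (Fin 3)) (P : MvPolynomial (Fin m) ℝ), (∀ i, IsBandTest N (g i)) → (∀ a : UnitAddTorus (Fin 3), a 1 = 0 → L • a = 0 → ∀ u : Torus.energySpace (Fin 3), IsLevel N u → MvPolynomial.eval (fun j => Torus.pairing u.1 (fun x => g j (x + a))) P = MvPolynomial.eval (fun j => Torus.pairing u.1 (g j)) P) → ∀ (a : UnitAddTorus (Fin 3)), a 1 = 0 → L • a = 0 → ∀ c : (Fin 3 → ℤ) → EuclideanSpace ℂ (Fin 3), Torus.IsTransversal ((Torus.freqBall N).erase 0) c → (∀ k ∉ (Torus.freqBall N).erase (0 : Fin 3 → ℤ), c k = 0) → MvPolynomial.eval (fun j => ∑ k ∈ (Torus.freqBall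 N).erase 0, ∑ i', ((UnitAddTorus.mFourier k (-a) : ℂ) • c k) i' * UnitAddTorus.mFourierCoeff (EuclideanSpace.complexify ∘ g j) (-k) i') (MvPolynomial.map (algebraMap ℝ ℂ) P) = MvPolynomial.eval (fun j => ∑ k ∈ (Torus.freqBall N).erase 0, ∑ i', c k i' * UnitAddTorus.mFourierCoeff (EuclideanSpace.complexify ∘ g j) (-k) i') (MvPolynomial.map (algebraMap ℝ ℂ) P) :=
  fun _ _ _ g P hg hobs a ha1 haL c hT hsupp => observableC_twist_eq_of_axialObs g hg P hobs a ha1 haL c hT hsupp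

end Summit.AnomalousDissipation.AnomalousDissipation.Theorems.MomentParityQuarticGate
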